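import Literature.Analysis.FluidPDE.PassiveScalarFourier
import Literature.Analysis.FluidPDE.PassiveScalarForcedClass
import Literature.Analysis.FunctionSpaces.DuBoisReymondAE
import HarnessLib

/-!
# Weak (sourced) passive scalars tested against steady smooth fields

Analysis/FluidPDE proof-support file (everything proved). For weak solutions of the passive
scalar equation on `T^d × [0,T)` — homogeneous (`Torus.IsWeakScalarTransportOn`,
`∂ₜθ + u·∇θ = κΔθ`) or with a source (`Torus.IsWeakScalarTransportForcedOn`,
`∂ₜθ + u·∇θ = κΔθ + s`) — and a smooth time-independent field `g : T^d → ℝ`, the pairing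
`t ↦ ∫ θ(t) g` has the absolutely continuous representative predicted by the equation:
for a.e. `t ∈ (0,T)`,

  `∫ θ(t) g = ∫ θ₀ g + ∫_{(0,t]} ( ∫ θ(τ) (⟪u(τ), ∇g⟫ + κΔg) + ∫ s(τ) g ) dτ`

(`IsWeakScalarTransportOn.ae_integral_mul_eq`, `IsWeakScalarTransportForcedOn.ae_integral_mul_eq`),
the weak formulation tested with `η(t) g(x)` (`….setIntegral_test_mul`, DiPerna–Lions 1989,
(14)) followed by the a.e. du Bois-Reymond lemma with datum
(`FunctionSpaces.ae_eq_add_setIntegral_of_forall_test`). With `g = 1`: **conservation of the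
mean up to the injected mass**, `∫ θ(t) = ∫ θ₀ + ∫_{(0,t]} ∫ s` for a.e. `t`
(`IsWeakScalarTransportForcedOn.ae_integral_eq`), in particular `∫ θ(t) = ∫ θ₀` for a mean-zero
source (DEIJ 2022, §1). The solution-class lemmas for the sourced notion are in
`PassiveScalarForcedClass`.

These are the "release tested against the source profile" and "trace of `(h, θ(·))`" inputs of
the age-decoupling argument (`FluidPDE/AgeDecouplingInequality`).

## References

* R. J. DiPerna, P.-L. Lions, Invent. Math. 98 (1989), §II.1, (13)–(14). [`DiPernaLions1989`]
* T. D. Drivas, T. M. Elgindi, G. Iyer, I.-J. Jeong, ARMA 243 (2022), §1, (1.1). [`DEIJ2022`]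
* H. Brezis, *Functional Analysis, Sobolev Spaces and PDE* (2011), Lemma 8.1. [`Brezis2011`]
-/

noncomputable section

open _root_.MeasureTheory _root_.Set _root_.Filter _root_.Function _root_.TopologicalSpace
open scoped ENNReal NNReal InnerProductSpace ContDiff

namespace Literature.Analysis.FluidPDE

namespace Torus

variable {d : Type*} [Fintype d]

/-! ## Homogeneous equation: the pairing with a steady smooth field -/

namespace IsWeakScalarTransportOn

variable {T κ : ℝ} {u : ℝ → UnitAddTorus d → EuclideanSpace ℝ d} {θ₀ : UnitAddTorus d → ℝ}
  {θ : ℝ → UnitAddTorus d → ℝ}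

/-- Integrability on `(0,T) × T^d` of `θ (⟪u, ∇g⟫ + κΔg)` for smooth steady `g`. [folklore] -/
theorem integrable_mul_steadyFlux (h : IsWeakScalarTransportOn T κ u θ₀ θ)
    {g : UnitAddTorus d → ℝ} (hg : FunctionSpaces.Torus.IsSmooth g) :
    Integrable (fun p : ℝ × UnitAddTorus d => θ p.1 p.2 *
      (⟪u p.1 p.2, FunctionSpaces.Torus.gradient g p.2⟫_ℝ + κ * FunctionSpaces.Torus.laplacian g p.2))
      (((volume : Measure ℝ).restrict (Ioo 0 T)).prod volume) := by
  have e : (fun p : ℝ × UnitAddTorus d => θ p.1 p.2 *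
      (⟪u p.1 p.2, FunctionSpaces.Torus.gradient g p.2⟫_ℝ + κ * FunctionSpaces.Torus.laplacian g p.2)) =
      fun p => θ p.1 p.2 * ⟪u p.1 p.2, FunctionSpaces.Torus.gradient g p.2⟫_ℝ +
        θ p.1 p.2 * (κ * FunctionSpaces.Torus.laplacian g p.2) := by
    funext p; ring
  rw [e]
  exact (h.integrable_mul_inner_continuous hg.gradient.continuous).add
    (h.integrable_mul_continuous (continuous_const.mul hg.laplacian.continuous))

/-- **A weak solution paired with a steady smooth field is absolutely continuous in time**:
for a.e. `t ∈ (0,T)`, `∫ θ(t) g = ∫ θ₀ g + ∫_{(0,t]} ∫ θ(τ) (⟪u(τ), ∇g⟫ + κΔg) dτ`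
(the weak formulation tested with `η(t) g(x)`, DiPerna–Lions 1989, (14), and the a.e.
du Bois-Reymond lemma with datum). [cite: DiPernaLions1989, §II.1 (14)] -/
theorem ae_integral_mul_eq (h : IsWeakScalarTransportOn T κ u θ₀ θ)
    {g : UnitAddTorus d → ℝ} (hg : FunctionSpaces.Torus.IsSmooth g) :
    ∀ᵐ t ∂(volume.restrict (Ioo 0 T)),
      ∫ x, θ t x * g x = (∫ x, θ₀ x * g x) +
        ∫ τ in Ioc 0 t, ∫ x, θ τ x *
          (⟪u τ x, FunctionSpaces.Torus.gradient g x⟫_ℝ + κ * FunctionSpaces.Torus.laplacian g x) := by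
  have hU : IntegrableOn (fun t => ∫ x, θ t x * g x) (Ioo 0 T) volume :=
    (h.integrable_mul_continuous hg.continuous).integral_prod_left
  have hF : IntegrableOn (fun t => ∫ x, θ t x *
      (⟪u t x, FunctionSpaces.Torus.gradient g x⟫_ℝ + κ * FunctionSpaces.Torus.laplacian g x))
      (Ioo 0 T) volume :=
    (h.integrable_mul_steadyFlux hg).integral_prod_left
  exact FunctionSpaces.ae_eq_add_setIntegral_of_forall_test hU hF fun η hη hηc hηT =>
    h.setIntegral_test_mul hη hηc hηT hg

end IsWeakScalarTransportOn

namespace IsWeakScalarTransportForcedOn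

variable {T κ : ℝ} {u : ℝ → UnitAddTorus d → EuclideanSpace ℝ d} {s : ℝ → UnitAddTorus d → ℝ}
  {θ₀ : UnitAddTorus d → ℝ} {θ : ℝ → UnitAddTorus d → ℝ}

/-! ## Sourced equation: the pairing with a steady smooth field -/

/-- **The sourced weak formulation tested with `η(t) g(x)`.** For a smooth compactly supported
`η` with `tsupport η ⊆ (-∞, T)` and a smooth `g : T^d → ℝ`,
`∫_{(0,T)} (η' ∫ θ g + η (∫ θ (⟪u, ∇g⟫ + κΔg) + ∫ s g)) + η(0) ∫ θ₀ g = 0`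
(DiPerna–Lions 1989, (13)–(14) with a right-hand side). [cite: DiPernaLions1989, §II.1 (13)–(14)] -/
theorem setIntegral_test_mul (h : IsWeakScalarTransportForcedOn T κ u s θ₀ θ) {η : ℝ → ℝ}
    (hη : ContDiff ℝ ∞ η) (hηc : HasCompactSupport η) (hηT : tsupport η ⊆ Iio T)
    {g : UnitAddTorus d → ℝ} (hg : FunctionSpaces.Torus.IsSmooth g) :
    (∫ t in Ioo 0 T, ((deriv η t * ∫ x, θ t x * g x) +
      η t * ((∫ x, θ t x * (⟪u t x, FunctionSpaces.Torus.gradient g x⟫_ℝ +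
        κ * FunctionSpaces.Torus.laplacian g x)) + ∫ x, s t x * g x))) +
      η 0 * ∫ x, θ₀ x * g x = 0 := by
  have hψ := isSpaceTimeTest_mul hη hηc hηT hg
  have hg1 : FunctionSpaces.Torus.IsContDiff 1 g := hg.isContDiff (by simp)
  have key := h.integral_prod_weak_eq hψ
  set P : Measure (ℝ × UnitAddTorus d) := ((volume : Measure ℝ).restrict (Ioo 0 T)).prod volume
    with hP
  -- pointwise form of the two integrands
  have hpt : ∀ p : ℝ × UnitAddTorus d, θ p.1 p.2 *
      (FunctionSpaces.Torus.timeDeriv (fun t x => η t * g x) p.1 p.2 +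
        ⟪u p.1 p.2, FunctionSpaces.Torus.gradient ((fun t x => η t * g x) p.1) p.2⟫_ℝ +
        κ * FunctionSpaces.Torus.laplacian ((fun t x => η t * g x) p.1) p.2) =
      deriv η p.1 * (θ p.1 p.2 * g p.2) +
        η p.1 * (θ p.1 p.2 * (⟪u p.1 p.2, FunctionSpaces.Torus.gradient g p.2⟫_ℝ +
          κ * FunctionSpaces.Torus.laplacian g p.2)) := by
    intro p
    rw [timeDeriv_mul, gradient_const_mul hg1, laplacian_const_mul hg, real_inner_smul_right]
    ring
  have hps : ∀ p : ℝ × UnitAddTorus d, s p.1 p.2 * (fun t x => η t * g x) p.1 p.2 =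
      η p.1 * (s p.1 p.2 * g p.2) := fun p => by simp only; ring
  obtain ⟨Ca, hCa⟩ := (hη.continuous_deriv (by simp)).bounded_above_of_compact_support hηc.deriv
  obtain ⟨Cb, hCb⟩ := hη.continuous.bounded_above_of_compact_support hηc
  set f₁ : ℝ × UnitAddTorus d → ℝ := fun p => deriv η p.1 * (θ p.1 p.2 * g p.2) with hf₁
  set f₂ : ℝ × UnitAddTorus d → ℝ := fun p =>
    η p.1 * (θ p.1 p.2 * (⟪u p.1 p.2, FunctionSpaces.Torus.gradient g p.2⟫_ℝ +
      κ * FunctionSpaces.Torus.laplacian g p.2)) with hf₂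
  set f₃ : ℝ × UnitAddTorus d → ℝ := fun p => η p.1 * (s p.1 p.2 * g p.2) with hf₃
  have hI₁ := h.integrable_mul_continuous hg.continuous
  have hI₂ := h.integrable_mul_steadyFlux hg
  have hI₃ := h.integrable_source_mul_continuous hg.continuous
  have hf₁i : Integrable f₁ P :=
    hI₁.bdd_mul ((hη.continuous_deriv (by simp)).comp continuous_fst).aestronglyMeasurable
      (Eventually.of_forall fun p => hCa p.1)
  have hf₂i : Integrable f₂ P :=
    hI₂.bdd_mul (hη.continuous.comp continuous_fst).aestronglyMeasurable
      (Eventually.of_forall fun p => hCb p.1)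
  have hf₃i : Integrable f₃ P :=
    hI₃.bdd_mul (hη.continuous.comp continuous_fst).aestronglyMeasurable
      (Eventually.of_forall fun p => hCb p.1)
  have esum : (∫ p, (f₁ p + f₂ p) ∂P) + (∫ p, f₃ p ∂P) + η 0 * ∫ x, θ₀ x * g x = 0 := by
    have e1 : ∫ p, (f₁ p + f₂ p) ∂P = ∫ p, θ p.1 p.2 *
        (FunctionSpaces.Torus.timeDeriv (fun t x => η t * g x) p.1 p.2 +
          ⟪u p.1 p.2, FunctionSpaces.Torus.gradient ((fun t x => η t * g x) p.1) p.2⟫_ℝ +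
          κ * FunctionSpaces.Torus.laplacian ((fun t x => η t * g x) p.1) p.2) ∂P :=
      integral_congr_ae (Eventually.of_forall fun p => (hpt p).symm)
    have e2 : η 0 * ∫ x, θ₀ x * g x = ∫ x, θ₀ x * (fun t x => η t * g x) 0 x := by
      rw [← integral_const_mul]
      exact integral_congr_ae (Eventually.of_forall fun x => by simp only; ring)
    have e3 : ∫ p, f₃ p ∂P = ∫ p, s p.1 p.2 * (fun t x => η t * g x) p.1 p.2 ∂P :=
      integral_congr_ae (Eventually.of_forall fun p => (hps p).symm)
    rw [e1, e2, e3]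
    exact key
  have e₁ : ∫ p, f₁ p ∂P = ∫ t in Ioo 0 T, deriv η t * ∫ x, θ t x * g x := by
    rw [hP, integral_prod _ hf₁i]
    refine integral_congr_ae (Eventually.of_forall fun t => ?_)
    simp only [hf₁]
    exact integral_const_mul _ _
  have e₂ : ∫ p, f₂ p ∂P = ∫ t in Ioo 0 T, η t * ∫ x, θ t x *
      (⟪u t x, FunctionSpaces.Torus.gradient g x⟫_ℝ + κ * FunctionSpaces.Torus.laplacian g x) := by
    rw [hP, integral_prod _ hf₂i]
    refine integral_congr_ae (Eventually.of_forall fun t => ?_)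
    simp only [hf₂]
    exact integral_const_mul _ _
  have e₃ : ∫ p, f₃ p ∂P = ∫ t in Ioo 0 T, η t * ∫ x, s t x * g x := by
    rw [hP, integral_prod _ hf₃i]
    refine integral_congr_ae (Eventually.of_forall fun t => ?_)
    simp only [hf₃]
    exact integral_const_mul _ _
  have ha : Integrable (fun t => deriv η t * ∫ x, θ t x * g x) (volume.restrict (Ioo 0 T)) := by
    refine hf₁i.integral_prod_left.congr (Eventually.of_forall fun t => ?_)
    simp only [hf₁]
    exact integral_const_mul _ _
  have hb : Integrable (fun t => η t * ∫ x, θ t x *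
      (⟪u t x, FunctionSpaces.Torus.gradient g x⟫_ℝ + κ * FunctionSpaces.Torus.laplacian g x))
      (volume.restrict (Ioo 0 T)) := by
    refine hf₂i.integral_prod_left.congr (Eventually.of_forall fun t => ?_)
    simp only [hf₂]
    exact integral_const_mul _ _
  have hc : Integrable (fun t => η t * ∫ x, s t x * g x) (volume.restrict (Ioo 0 T)) := by
    refine hf₃i.integral_prod_left.congr (Eventually.of_forall fun t => ?_)
    simp only [hf₃]
    exact integral_const_mul _ _
  rw [integral_add hf₁i hf₂i, e₁, e₂, e₃] at esum
  have esplit : ∀ t, (deriv η t * ∫ x, θ t x * g x) +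
      η t * ((∫ x, θ t x * (⟪u t x, FunctionSpaces.Torus.gradient g x⟫_ℝ +
        κ * FunctionSpaces.Torus.laplacian g x)) + ∫ x, s t x * g x) =
      ((deriv η t * ∫ x, θ t x * g x) +
        η t * ∫ x, θ t x * (⟪u t x, FunctionSpaces.Torus.gradient g x⟫_ℝ +
          κ * FunctionSpaces.Torus.laplacian g x)) + η t * ∫ x, s t x * g x := fun t => by ring
  have hab : Integrable (fun t => (deriv η t * ∫ x, θ t x * g x) +
      η t * ∫ x, θ t x * (⟪u t x, FunctionSpaces.Torus.gradient g x⟫_ℝ +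
        κ * FunctionSpaces.Torus.laplacian g x)) (volume.restrict (Ioo 0 T)) := ha.add hb
  simp_rw [esplit]
  rw [integral_add hab hc, integral_add ha hb]
  linarith

/-- **A sourced weak solution paired with a steady smooth field is absolutely continuous in
time**: for a.e. `t ∈ (0,T)`,
`∫ θ(t) g = ∫ θ₀ g + ∫_{(0,t]} (∫ θ(τ) (⟪u(τ), ∇g⟫ + κΔg) + ∫ s(τ) g) dτ`
(`setIntegral_test_mul` and the a.e. du Bois-Reymond lemma with datum).
[cite: DiPernaLions1989, §II.1 (13)–(14)] -/
theorem ae_integral_mul_eq (h : IsWeakScalarTransportForcedOn T κ u s θ₀ θ)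
    {g : UnitAddTorus d → ℝ} (hg : FunctionSpaces.Torus.IsSmooth g) :
    ∀ᵐ t ∂(volume.restrict (Ioo 0 T)),
      ∫ x, θ t x * g x = (∫ x, θ₀ x * g x) +
        ∫ τ in Ioc 0 t, ((∫ x, θ τ x *
          (⟪u τ x, FunctionSpaces.Torus.gradient g x⟫_ℝ + κ * FunctionSpaces.Torus.laplacian g x)) +
          ∫ x, s τ x * g x) := by
  have hU : IntegrableOn (fun t => ∫ x, θ t x * g x) (Ioo 0 T) volume :=
    (h.integrable_mul_continuous hg.continuous).integral_prod_left
  have hF : IntegrableOn (fun t => (∫ x, θ t x *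
      (⟪u t x, FunctionSpaces.Torus.gradient g x⟫_ℝ + κ * FunctionSpaces.Torus.laplacian g x)) +
      ∫ x, s t x * g x) (Ioo 0 T) volume :=
    (h.integrable_mul_steadyFlux hg).integral_prod_left.add
      (h.integrable_source_mul_continuous hg.continuous).integral_prod_left
  exact FunctionSpaces.ae_eq_add_setIntegral_of_forall_test hU hF fun η hη hηc hηT =>
    h.setIntegral_test_mul hη hηc hηT hg

/-- **Conservation of the mean up to the injected mass** for sourced weak solutions: for a.e.
`t ∈ (0,T)`, `∫ θ(t) = ∫ θ₀ + ∫_{(0,t]} ∫ s(τ) dτ` (`g = 1`: `∇1 = 0`, `Δ1 = 0`); for a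
mean-zero source the scalar mean is constant (DEIJ 2022, §1). [cite: DEIJ2022, §1 (1.1)] -/
theorem ae_integral_eq (h : IsWeakScalarTransportForcedOn T κ u s θ₀ θ) :
    ∀ᵐ t ∂(volume.restrict (Ioo 0 T)),
      ∫ x, θ t x = (∫ x, θ₀ x) + ∫ τ in Ioc 0 t, ∫ x, s τ x := by
  classical
  have h1 := h.ae_integral_mul_eq (FunctionSpaces.Torus.isSmooth_const (1 : ℝ))
  have hg0 : ∀ x : UnitAddTorus d, FunctionSpaces.Torus.gradient (fun _ : UnitAddTorus d => (1 : ℝ)) x = 0 := by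
    intro x
    have hl : FunctionSpaces.Torus.liftAt (fun _ : UnitAddTorus d => (1 : ℝ)) x = fun _ => 1 := by
      funext v; simp [FunctionSpaces.Torus.liftAt_apply]
    simp [FunctionSpaces.Torus.gradient, hl]
  have hl0 : ∀ x : UnitAddTorus d, FunctionSpaces.Torus.laplacian (fun _ : UnitAddTorus d => (1 : ℝ)) x = 0 := by
    intro x
    rw [FunctionSpaces.Torus.laplacian_eq_sum_partialDeriv_partialDeriv
      (FunctionSpaces.Torus.isSmooth_const (1 : ℝ))]
    simp [FunctionSpaces.Torus.partialDeriv, FunctionSpaces.Torus.lineDeriv]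
  filter_upwards [h1] with t ht
  simpa [hg0, hl0] using ht

end IsWeakScalarTransportForcedOn

end Torus

end Literature.Analysis.FluidPDE

end
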